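import Mathlib
import HarnessLib
import Literature.MathematicalPhysics.StatisticalMechanics.LatticeSobolevLine

/-!
# The discrete Sobolev inequality on lattice cubes, mixed-derivative form
# (Adams–Buchholz–Kotecký–Müller Lemma 7.9; Brydges–Slade form with one derivative per direction)

[ABKM19] Lemma 7.9: for a lattice cube of side `ℓ` in `ℤ^d`,
`max_{x∈B_ℓ} |f(x)| ≤ S(d) ℓ^{−d/2} Σ_{0≤|α|≤M'} ‖(ℓ∇)^α f‖₂` ("a similar claim with `d` derivatives
appeared in [BGM04, Prop. B2] and [BS15I, Lemma 6.6]").  This file proves the version with MIXED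
derivatives `α ∈ {0,1}^d` (which suffices for Theorem 7.1 (w9) once the order `M` of the operators
`M_k` is taken `≥ p_Φ + d`), by iterating the one-dimensional estimate `sq_le_line` over the
coordinate directions:

* `mixedDiff α f = ∇^{𝟙_α} f` for `α : Finset (Fin d)`; `mixedDiff_insert` (`∇_i∇^α = ∇^{α∪{i}}`);
* `boxShift T v = (k ↦ [k ∈ T]·v_k)` — the points `x + boxShift T v`, `v : Fin d → Fin ℓ`, run over
  the `T`-face of the cube through `x` (each `ℓ^{d−|T|}` times); `sum_sum_boxShift_insert` (Fubini);
* **`sq_le_sum_mixedDiff_sq`** — for every `T ⊆ Fin d`, `ℓ ≥ 1`: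
  `f(x)² ≤ 2^{|T|} Σ_{α⊆T} ℓ^{2|α|} ℓ^{−d} Σ_{v : Fin d → Fin ℓ} (∇^{𝟙_α} f(x + boxShift T v))²`;
  with `T = univ` this is Lemma 7.9 (squared, mixed form, constant `S(d)² = 2^d`):
  `f(x)² ≤ 2^d Σ_{α⊆[d]} ℓ^{2|α|−d} ‖∇^α f‖²_{ℓ²(x + [0,ℓ)^d)}`.

Everything is proved; no named fact.

## References
* S. Adams, S. Buchholz, R. Kotecký, S. Müller, arXiv:1910.13564, Lemma 7.9 [AdamsBuchholzKoteckyMuller2019].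
-/

noncomputable section

namespace Literature.MathematicalPhysics.StatisticalMechanics.GradientRG

open Finset
open Literature.MathematicalPhysics.StatisticalMechanics.GradientFRD (iterDiff)

variable {d M : ℕ}

/-! ## Mixed derivatives indexed by sets of directions -/

/-- **`∇^{𝟙_α}`**: one forward derivative in each direction of `α`.
[cite: AdamsBuchholzKoteckyMuller2019, Lemma 7.9] -/
def mixedDiff (α : Finset (Fin d)) (f : (Fin d → ZMod M) → ℝ) : (Fin d → ZMod M) → ℝ :=
  iterDiff (fun k => if k ∈ α then 1 else 0) f

/-- `∇^{𝟙_∅} = id`. [cite: AdamsBuchholzKoteckyMuller2019, Lemma 7.9] -/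
theorem mixedDiff_empty (f : (Fin d → ZMod M) → ℝ) : mixedDiff ∅ f = f := by
  unfold mixedDiff iterDiff
  have h : ∀ l : List (Fin d),
      l.foldr (fun i g => (GradientFRD.fwdDiff i)^[(fun k : Fin d => if k ∈ (∅ : Finset (Fin d)) then 1 else 0) i] g) f = f := by
    intro l; induction l with
    | nil => rfl
    | cons i l ih => rw [List.foldr_cons, ih]; simp
  exact h _

/-- **`∇^{𝟙_{α∪{i}}} = ∇_i ∇^{𝟙_α}`** for `i ∉ α`. [cite: AdamsBuchholzKoteckyMuller2019, Lemma 7.9] -/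
theorem mixedDiff_insert {α : Finset (Fin d)} {i : Fin d} (hi : i ∉ α) (f : (Fin d → ZMod M) → ℝ) :
    mixedDiff (insert i α) f = GradientFRD.fwdDiff i (mixedDiff α f) := by
  unfold mixedDiff
  rw [← iterDiff_add_single]
  congr 1
  funext k
  by_cases hk : k = i
  · subst hk; simp [hi]
  · simp [hk]

/-! ## Faces of the cube -/

/-- The shift `boxShift T v = (k ↦ [k ∈ T] v_k)` (coordinates outside `T` frozen).
[cite: AdamsBuchholzKoteckyMuller2019, Lemma 7.9] -/
def boxShift {ℓ : ℕ} (T : Finset (Fin d)) (v : Fin d → Fin ℓ) : Fin d → ZMod M :=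
  fun k => if k ∈ T then (((v k : ℕ)) : ZMod M) else 0

/-- `boxShift ∅ v = 0`. [cite: AdamsBuchholzKoteckyMuller2019, Lemma 7.9] -/
theorem boxShift_empty {ℓ : ℕ} (v : Fin d → Fin ℓ) : boxShift (M := M) ∅ v = 0 := by
  funext k; simp [boxShift]

/-- Adding one direction: `boxShift (insert i T) (e⁻¹(j, w)) = boxShift T (e⁻¹(a, w)) + j e_i` for
`i ∉ T`, `e = funSplitAt i`. [cite: AdamsBuchholzKoteckyMuller2019, Lemma 7.9] -/
theorem boxShift_insert {ℓ : ℕ} {T : Finset (Fin d)} {i : Fin d} (hi : i ∉ T)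
    (a j : Fin ℓ) (w : {k // k ≠ i} → Fin ℓ) :
    boxShift (M := M) (insert i T) ((Equiv.funSplitAt i (Fin ℓ)).symm (j, w)) =
      boxShift T ((Equiv.funSplitAt i (Fin ℓ)).symm (a, w)) + Pi.single i (((j : ℕ)) : ZMod M) := by
  funext k
  by_cases hk : k = i
  · subst hk
    simp [boxShift, hi]
  · have hkT : (k ∈ insert i T) ↔ k ∈ T := by simp [hk]
    simp [boxShift, hk, Equiv.funSplitAt_symm_apply]

/-- **Fubini for the faces**: for `i ∉ T`,
`Σ_v Σ_{j : Fin ℓ} G(boxShift T v + j e_i) = ℓ · Σ_v G(boxShift (insert i T) v)`.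
[cite: AdamsBuchholzKoteckyMuller2019, Lemma 7.9] -/
theorem sum_sum_boxShift_insert {ℓ : ℕ} {T : Finset (Fin d)} {i : Fin d} (hi : i ∉ T)
    (G : (Fin d → ZMod M) → ℝ) :
    ∑ v : Fin d → Fin ℓ, ∑ j : Fin ℓ, G (boxShift T v + Pi.single i (((j : ℕ)) : ZMod M)) =
      (ℓ : ℝ) * ∑ v : Fin d → Fin ℓ, G (boxShift (insert i T) v) := by
  set e := Equiv.funSplitAt i (Fin ℓ) with he
  -- reindex both sides through `e`
  have hL : ∑ v : Fin d → Fin ℓ, ∑ j : Fin ℓ, G (boxShift T v + Pi.single i (((j : ℕ)) : ZMod M)) =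
      ∑ p : Fin ℓ × ({k // k ≠ i} → Fin ℓ), ∑ j : Fin ℓ,
        G (boxShift T (e.symm p) + Pi.single i (((j : ℕ)) : ZMod M)) := by
    rw [← Equiv.sum_comp e.symm]
  have hR : ∑ v : Fin d → Fin ℓ, G (boxShift (insert i T) v) =
      ∑ p : Fin ℓ × ({k // k ≠ i} → Fin ℓ), G (boxShift (insert i T) (e.symm p)) := by
    rw [← Equiv.sum_comp e.symm]
  rw [hL, hR, Fintype.sum_prod_type, Fintype.sum_prod_type]
  -- inner sums: independent of the first component on the left
  have hinner : ∀ a : Fin ℓ, ∀ w : {k // k ≠ i} → Fin ℓ,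
      ∑ j : Fin ℓ, G (boxShift T (e.symm (a, w)) + Pi.single i (((j : ℕ)) : ZMod M)) =
        ∑ j : Fin ℓ, G (boxShift (insert i T) (e.symm (j, w))) := by
    intro a w
    exact Fintype.sum_congr _ _ fun j => by rw [boxShift_insert hi a j w]
  simp_rw [hinner]
  rw [sum_const, card_univ, Fintype.card_fin, nsmul_eq_mul, sum_comm, Finset.mul_sum]

/-! ## The inequality -/

/-- **Discrete Sobolev inequality, mixed form, on the `T`-faces** ([ABKM19] Lemma 7.9, proof by
induction on the directions): for `ℓ ≥ 1`, every `T`, `f`, `x`: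
`f(x)² ≤ 2^{|T|} Σ_{α⊆T} (ℓ^{2|α|}/ℓ^d) Σ_{v : Fin d → Fin ℓ} (∇^{𝟙_α} f(x + boxShift T v))²`.
[cite: AdamsBuchholzKoteckyMuller2019, Lemma 7.9] -/
theorem sq_le_sum_mixedDiff_sq {ℓ : ℕ} (hℓ : 1 ≤ ℓ) (T : Finset (Fin d)) (f : (Fin d → ZMod M) → ℝ)
    (x : Fin d → ZMod M) :
    f x ^ 2 ≤ 2 ^ T.card * ∑ α ∈ T.powerset, ((ℓ : ℝ) ^ (2 * α.card) / (ℓ : ℝ) ^ d) *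
      ∑ v : Fin d → Fin ℓ, (mixedDiff α f (x + boxShift T v)) ^ 2 := by
  have hℓr : (0 : ℝ) < ℓ := by exact_mod_cast (show 0 < ℓ by omega)
  induction T using Finset.induction_on generalizing f x with
  | empty =>
    simp only [card_empty, pow_zero, one_mul, powerset_empty, sum_singleton, mul_zero, boxShift_empty,
      add_zero, mixedDiff_empty]
    rw [sum_const, card_univ, Fintype.card_fun, Fintype.card_fin, Fintype.card_fin, nsmul_eq_mul]
    push_cast
    apply le_of_eq
    field_simp
  | insert i T hi ih =>
    -- Step 1: the induction hypothesis
    have h1 := ih f x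
    -- Step 2: the one-dimensional estimate at every face point, in direction `i`
    have h2 : ∀ α ∈ T.powerset, ∀ v : Fin d → Fin ℓ,
        (mixedDiff α f (x + boxShift T v)) ^ 2 ≤
          2 * (ℓ : ℝ)⁻¹ * ∑ j : Fin ℓ, (mixedDiff α f (x + boxShift T v + Pi.single i (((j : ℕ)) : ZMod M))) ^ 2 +
          2 * (ℓ : ℝ) * ∑ j : Fin ℓ,
            (GradientFRD.fwdDiff i (mixedDiff α f) (x + boxShift T v + Pi.single i (((j : ℕ)) : ZMod M))) ^ 2 := by
      intro α _ v
      have h := sq_le_line (mixedDiff α f) (x + boxShift T v) i (ℓ := ℓ) (j₀ := 0) (by omega)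
      rw [Nat.cast_zero, Pi.single_zero, add_zero] at h
      rw [Finset.sum_range, Finset.sum_range] at h
      exact h
    -- Step 3: sum over the face and use Fubini
    have h3 : ∀ α ∈ T.powerset,
        ∑ v : Fin d → Fin ℓ, (mixedDiff α f (x + boxShift T v)) ^ 2 ≤
          2 * ∑ v : Fin d → Fin ℓ, (mixedDiff α f (x + boxShift (insert i T) v)) ^ 2 +
          2 * (ℓ : ℝ) ^ 2 * ∑ v : Fin d → Fin ℓ, (mixedDiff (insert i α) f (x + boxShift (insert i T) v)) ^ 2 := by
      intro α hα
      have hiα : i ∉ α := fun h => hi (Finset.mem_powerset.1 hα h)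
      have hs := Finset.sum_le_sum fun v (_ : v ∈ (Finset.univ : Finset (Fin d → Fin ℓ))) => h2 α hα v
      rw [sum_add_distrib, ← mul_sum, ← mul_sum] at hs
      have hF1 := sum_sum_boxShift_insert (M := M) (ℓ := ℓ) hi (fun y => (mixedDiff α f (x + y)) ^ 2)
      have hF2 := sum_sum_boxShift_insert (M := M) (ℓ := ℓ) hi
        (fun y => (GradientFRD.fwdDiff i (mixedDiff α f) (x + y)) ^ 2)
      simp only [add_assoc] at hF1 hF2 hs
      rw [hF1, hF2] at hs
      simp only [← mixedDiff_insert hiα] at hs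
      refine hs.trans (le_of_eq ?_)
      field_simp
    -- Step 4: regroup the sum over `α ⊆ insert i T`
    rw [Finset.card_insert_of_notMem hi, Finset.powerset_insert, Finset.sum_union
      (Finset.disjoint_left.2 fun α hα hα' => by
        obtain ⟨β, _, rfl⟩ := Finset.mem_image.1 hα'
        exact hi (Finset.mem_powerset.1 hα (Finset.mem_insert_self i β))),
      Finset.sum_image (fun β hβ γ hγ h => by
        have hβi : i ∉ β := fun h' => hi (Finset.mem_powerset.1 hβ h')
        have hγi : i ∉ γ := fun h' => hi (Finset.mem_powerset.1 hγ h')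
        rw [← Finset.erase_insert hβi, ← Finset.erase_insert hγi, h])]
    -- combine
    calc f x ^ 2 ≤ 2 ^ T.card * ∑ α ∈ T.powerset, ((ℓ : ℝ) ^ (2 * α.card) / (ℓ : ℝ) ^ d) *
          ∑ v : Fin d → Fin ℓ, (mixedDiff α f (x + boxShift T v)) ^ 2 := h1
      _ ≤ 2 ^ T.card * ∑ α ∈ T.powerset, ((ℓ : ℝ) ^ (2 * α.card) / (ℓ : ℝ) ^ d) *
          (2 * ∑ v : Fin d → Fin ℓ, (mixedDiff α f (x + boxShift (insert i T) v)) ^ 2 +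
            2 * (ℓ : ℝ) ^ 2 *
              ∑ v : Fin d → Fin ℓ, (mixedDiff (insert i α) f (x + boxShift (insert i T) v)) ^ 2) := by
          refine mul_le_mul_of_nonneg_left (sum_le_sum fun α hα => ?_) (by positivity)
          exact mul_le_mul_of_nonneg_left (h3 α hα) (by positivity)
      _ = 2 ^ (T.card + 1) *
          (∑ α ∈ T.powerset, ((ℓ : ℝ) ^ (2 * α.card) / (ℓ : ℝ) ^ d) *
              ∑ v : Fin d → Fin ℓ, (mixedDiff α f (x + boxShift (insert i T) v)) ^ 2 +
            ∑ α ∈ T.powerset, ((ℓ : ℝ) ^ (2 * (insert i α).card) / (ℓ : ℝ) ^ d) *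
              ∑ v : Fin d → Fin ℓ, (mixedDiff (insert i α) f (x + boxShift (insert i T) v)) ^ 2) := by
          rw [← sum_add_distrib, Finset.mul_sum, Finset.mul_sum]
          refine sum_congr rfl fun α hα => ?_
          have hiα : i ∉ α := fun h => hi (Finset.mem_powerset.1 hα h)
          rw [Finset.card_insert_of_notMem hiα]
          ring

end Literature.MathematicalPhysics.StatisticalMechanics.GradientRG

end
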